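import Summits.ValiantsHypothesis.ValiantsHypothesis.Theorems.LacunarySymmetroidMatrixDescartesCensusChamberSignClass
import Summits.ValiantsHypothesis.ValiantsHypothesis.Theorems.LacunarySymmetroidMatrixDescartesCensusDoorA

/-!
# `MatrixDescartes` census — DOOR A REDUCES TO CHAMBER ROWS: `DoorA26` ↔ the chamber-uniform row for every pair order

HONEST FRAMING.  Object-search cell `pub-symmetroid`, door-A target `DoorA26 := PosRootLawAt 2 6 19`
(stmt-ValiantsHypothesis-19979; OPEN, typed, never asserted), crux `Theses.LacunarySymmetroid.MatrixDescartes`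
(stmt-ValiantsHypothesis-18050).  The cell's programme for door A (theory g6 CHAMBERS-2-6.md, UNIFORM-NC-SLOPE-g6.md;
director-valiant 2026-08-26: «the missing object = a box/chamber-reduction lemma bringing every support into a finite
certificate list») works chamber by chamber: a CHAMBER is an order type of the 21 pair sums `dᵢ + dⱼ` of a 2-Sidon support,
given as data `σ : Fin 21 → Fin 6 × Fin 6` with the hypothesis `StrictMono ((fun p => d p.1 + d p.2) ∘ σ)` (20 strict linear
inequalities in a SYMBOLIC `d`; …CensusChamberSignClass.lean).  This file proves the reduction itself, with no list of
chambers and no completeness claim needed: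

* `image_pairSum_eq_image_canonical` — the pair-sum set is the image of the 21 canonical pairs `i ≤ j`;
* `posRootLawOn_of_pairSum_collision` — a support on which two distinct canonical pairs have the same sum carries at most
  `20` monomials, hence `ζ(2,6; d) ≤ 19` by the support's own Descartes count (tree: `posRoots_two_le_of_card_pairSums`);
* `exists_chamberOrder_of_injOn` — a support with 21 distinct pair sums lies in the chamber of SOME covering order `σ`
  (sort the canonical pairs by their sums: `Finset.orderEmbOfFin`);
* **`doorA26_iff_forall_chamberOrder`** — `DoorA26` holds iff for EVERY covering order `σ : Fin 21 → Fin 6 × Fin 6` the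
  chamber-uniform row `∀ d, StrictMono ((fun p => d p.1 + d p.2) ∘ σ) → PosRootLawOn 2 6 19 d` holds.  The quantifier over
  `σ` ranges over a FINITE type; orders that no support realises contribute vacuous rows, so door A is EXACTLY the
  conjunction of the chamber rows of the realisable orders (2 608 of them by the cell's three enumerations — a count this
  file neither uses nor proves).  Chamber rows in the kernel so far: the 126 parity-dead chambers
  (…CensusChamberSignClass{,A,B,C,D}); one orientation of ~1 900 more is available from …CensusChamberSignCell; every
  other row needs magnitude arguments uniform in the chamber, which do NOT exist in the tree (the BOX20 / uniform-ray
  theorems are support- or ray-level).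

Nothing here bears on `V = 19`, on the truth of `DoorA26` (OPEN), on the crux, or on `VP ≠ VNP`.

[folklore] Elementary bookkeeping (sorting a finite set, Descartes on the support); no citation exists or is needed.
-/

-- `Summit.ValiantsHypothesis.ValiantsHypothesis.…` repeats a component by the D-0017 layout
-- (single-conjunct summit), which the `dupNamespace` linter flags; the name is mandated.
set_option linter.dupNamespace false

namespace Summit.ValiantsHypothesis.ValiantsHypothesis.Theorems.LacunarySymmetroidMatrixDescartes.Census

open Polynomial Finset
open scoped BigOperators Polynomial Matrix
open Summit.ValiantsHypothesis.ValiantsHypothesis.Theorems.MatrixDescartes.Negative (PosRootLawAt)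

/-! ## Canonical pairs and collisions -/

/-- The pair-sum set of `d` is already the image of the 21 CANONICAL pairs `(i, j)`, `i ≤ j`. [folklore] -/
theorem image_pairSum_eq_image_canonical (d : Fin 6 → ℕ) :
    (univ : Finset (Fin 6 × Fin 6)).image (fun p => d p.1 + d p.2)
      = ((univ : Finset (Fin 6 × Fin 6)).filter (fun p => p.1 ≤ p.2)).image (fun p => d p.1 + d p.2) := by
  ext e
  simp only [mem_image, mem_univ, true_and, mem_filter]
  constructor
  · rintro ⟨p, rfl⟩
    rcases le_total p.1 p.2 with h | h
    · exact ⟨p, h, rfl⟩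
    · exact ⟨p.swap, by simpa using h, by simp [add_comm]⟩
  · rintro ⟨p, -, rfl⟩
    exact ⟨p, rfl⟩

/-- There are `21` canonical pairs. [folklore] -/
theorem card_canonicalPairs : ((univ : Finset (Fin 6 × Fin 6)).filter (fun p => p.1 ≤ p.2)).card = 21 := by
  decide

/-- **Collided supports are free.**  If two distinct canonical pairs of indices have the same exponent sum, the
determinant of every real symmetric `2 × 2` pencil on `d` has at most `20` monomials and hence at most `19` distinct
positive roots (the support's own Descartes bound, `posRoots_two_le_of_card_pairSums`). [folklore] -/
theorem posRootLawOn_of_pairSum_collision (d : Fin 6 → ℕ) (p q : Fin 6 × Fin 6) (hp : p.1 ≤ p.2) (hq : q.1 ≤ q.2)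
    (hpq : p ≠ q) (h : d p.1 + d p.2 = d q.1 + d q.2) : PosRootLawOn 2 6 19 d := by
  set T := (univ : Finset (Fin 6 × Fin 6)).filter (fun p => p.1 ≤ p.2) with hT
  have hqT : q ∈ T.erase p := mem_erase.mpr ⟨hpq.symm, mem_filter.mpr ⟨mem_univ _, hq⟩⟩
  have himg : T.image (fun p => d p.1 + d p.2) = (T.erase p).image (fun p => d p.1 + d p.2) := by
    apply Subset.antisymm
    · intro e he
      obtain ⟨r, hr, rfl⟩ := mem_image.mp he
      by_cases hrp : r = p
      · subst hrp
        exact mem_image.mpr ⟨q, hqT, h.symm⟩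
      · exact mem_image.mpr ⟨r, mem_erase.mpr ⟨hrp, hr⟩, rfl⟩
    · exact image_subset_image (erase_subset _ _)
  have hpT : p ∈ T := mem_filter.mpr ⟨mem_univ _, hp⟩
  have hTcard : T.card = 21 := by rw [hT]; exact card_canonicalPairs
  have hc : ((univ : Finset (Fin 6 × Fin 6)).image (fun p => d p.1 + d p.2)).card ≤ 19 + 1 := by
    rw [image_pairSum_eq_image_canonical, ← hT, himg]
    refine card_image_le.trans ?_
    rw [card_erase_of_mem hpT]
    omega
  exact fun S _ => posRoots_two_le_of_card_pairSums (by norm_num) d hc S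

/-! ## Generic supports lie in a chamber -/

/-- **Every 2-Sidon support lies in some chamber**: if the canonical pair sums of `d` are pairwise distinct, there is an
order `σ` of the 21 pairs covering every pair up to swap along which the sums strictly increase (sort them). [folklore] -/
theorem exists_chamberOrder_of_injOn (d : Fin 6 → ℕ)
    (hinj : Set.InjOn (fun p : Fin 6 × Fin 6 => d p.1 + d p.2)
      ↑((univ : Finset (Fin 6 × Fin 6)).filter (fun p => p.1 ≤ p.2))) :
    ∃ σ : Fin 21 → Fin 6 × Fin 6, (∀ p : Fin 6 × Fin 6, ∃ t : Fin 21, σ t = p ∨ σ t = p.swap) ∧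
      StrictMono ((fun p : Fin 6 × Fin 6 => d p.1 + d p.2) ∘ σ) := by
  classical
  set T := (univ : Finset (Fin 6 × Fin 6)).filter (fun p => p.1 ≤ p.2) with hT
  set f : Fin 6 × Fin 6 → ℕ := fun p => d p.1 + d p.2 with hf
  set W := T.image f with hW
  have hWcard : W.card = 21 := by rw [hW, card_image_of_injOn hinj, hT]; exact card_canonicalPairs
  -- the increasing enumeration of the 21 sums
  set emb := W.orderEmbOfFin hWcard with hemb
  have hmem : ∀ t : Fin 21, emb t ∈ W := fun t => Finset.orderEmbOfFin_mem W hWcard t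
  have hex : ∀ t : Fin 21, ∃ p : Fin 6 × Fin 6, p ∈ T ∧ f p = emb t := by
    intro t
    obtain ⟨p, hp, hpe⟩ := mem_image.mp (hmem t)
    exact ⟨p, hp, hpe⟩
  choose σ hσT hσf using hex
  refine ⟨σ, ?_, ?_⟩
  · -- covering: the canonical representative of `p` has its sum in `W = range emb`
    intro p
    have key : ∀ c : Fin 6 × Fin 6, c ∈ T → ∃ t : Fin 21, σ t = c := by
      intro c hc
      have hcW : f c ∈ (W : Set ℕ) := by
        rw [Finset.mem_coe]; exact mem_image.mpr ⟨c, hc, rfl⟩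
      rw [← Finset.range_orderEmbOfFin W hWcard, Set.mem_range] at hcW
      obtain ⟨t, ht⟩ := hcW
      refine ⟨t, hinj (hσT t) hc ?_⟩
      show f (σ t) = f c
      rw [hσf t]; exact ht
    rcases le_total p.1 p.2 with h | h
    · obtain ⟨t, ht⟩ := key p (mem_filter.mpr ⟨mem_univ _, h⟩)
      exact ⟨t, Or.inl ht⟩
    · obtain ⟨t, ht⟩ := key p.swap (mem_filter.mpr ⟨mem_univ _, by simpa using h⟩)
      exact ⟨t, Or.inr ht⟩
  · -- monotone: the sums along `σ` ARE the increasing enumeration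
    intro s t hst
    show f (σ s) < f (σ t)
    rw [hσf s, hσf t]
    exact (W.orderEmbOfFin hWcard).strictMono hst

/-! ## The reduction -/

/-- **DOOR A ↔ CHAMBER ROWS.**  `DoorA26` (no real symmetric `2 × 2` six-term pencil has `20` distinct positive
det-roots) holds iff for every covering order `σ` of the 21 index pairs the CHAMBER-UNIFORM row holds: every exponent
vector whose pair sums increase along `σ` satisfies `ζ(2,6; d) ≤ 19`.  (←): a support either has a repeated canonical
pair sum (then Descartes on ≤ 20 monomials, `posRootLawOn_of_pairSum_collision`) or lies in the chamber of the order
obtained by sorting its sums (`exists_chamberOrder_of_injOn`).  The right-hand side quantifies over a FINITE type of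
orders; unrealisable orders contribute vacuously. [folklore] -/
theorem doorA26_iff_forall_chamberOrder :
    DoorA26 ↔ ∀ σ : Fin 21 → Fin 6 × Fin 6, (∀ p : Fin 6 × Fin 6, ∃ t : Fin 21, σ t = p ∨ σ t = p.swap) →
      ∀ d : Fin 6 → ℕ, StrictMono ((fun p : Fin 6 × Fin 6 => d p.1 + d p.2) ∘ σ) → PosRootLawOn 2 6 19 d := by
  classical
  constructor
  · intro hA σ _ d _
    exact posRootLawOn_of_posRootLawAt hA d
  · intro h d
    by_cases hinj : Set.InjOn (fun p : Fin 6 × Fin 6 => d p.1 + d p.2)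
        ↑((univ : Finset (Fin 6 × Fin 6)).filter (fun p => p.1 ≤ p.2))
    · obtain ⟨σ, hcov, hmono⟩ := exists_chamberOrder_of_injOn d hinj
      exact h σ hcov d hmono
    · -- a collision of two canonical pairs
      simp only [Set.InjOn, not_forall, Finset.mem_coe, mem_filter, mem_univ, true_and, exists_prop] at hinj
      obtain ⟨p, hp, q, hq, hpq, hne⟩ := hinj
      exact posRootLawOn_of_pairSum_collision d p q hp hq hne hpq

/-- **Pointwise form of the reduction** (the one a chamber cover uses support by support): the door-A row on `d` follows
from the chamber rows of the covering orders `σ` that sort `d`'s sums — for a collided support nothing is needed.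
[folklore] -/
theorem posRootLawOn_of_chamberRows (d : Fin 6 → ℕ)
    (h : ∀ σ : Fin 21 → Fin 6 × Fin 6, (∀ p : Fin 6 × Fin 6, ∃ t : Fin 21, σ t = p ∨ σ t = p.swap) →
      StrictMono ((fun p : Fin 6 × Fin 6 => d p.1 + d p.2) ∘ σ) → PosRootLawOn 2 6 19 d) :
    PosRootLawOn 2 6 19 d := by
  classical
  by_cases hinj : Set.InjOn (fun p : Fin 6 × Fin 6 => d p.1 + d p.2)
      ↑((univ : Finset (Fin 6 × Fin 6)).filter (fun p => p.1 ≤ p.2))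
  · obtain ⟨σ, hcov, hmono⟩ := exists_chamberOrder_of_injOn d hinj
    exact h σ hcov hmono
  · simp only [Set.InjOn, not_forall, Finset.mem_coe, mem_filter, mem_univ, true_and, exists_prop] at hinj
    obtain ⟨p, hp, q, hq, hpq, hne⟩ := hinj
    exact posRootLawOn_of_pairSum_collision d p q hp hq hne hpq

end Summit.ValiantsHypothesis.ValiantsHypothesis.Theorems.LacunarySymmetroidMatrixDescartes.Census
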